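import Mathlib
import HarnessLib
import Summits.Ventures.LatticeQCDFlow.Exactness.IMHCommonRandomNumbersContraction
import Summits.Ventures.LatticeQCDFlow.Scaling.AutoregressiveGaugeHeatBathColdExact

/-!
# LatticeQCDFlow / Scaling — shared random numbers contract the disagreement probability of two runs of the exact one-plaquette heat-bath sampler (`A = Z/(c^{#B}M^k)`): `P(U_n ≠ U′_n) ≤ (1 − A)ⁿ·P(U_0 ≠ U′_0)` (Hausdorff `G`)

HONEST FRAMING: exact (Metropolis-corrected) sampling algorithms for lattice gauge theory;
figures of merit are autocorrelation/cost numbers at stated couplings and volumes; no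
continuum-physics claim.

Venture `LatticeQCDFlow` (cell pub-lqcd), topic `Scaling`, FANOUT row 30 (lean-1, GEN-37) — OUR WORK, the gauge instance of this
generation's abstract `Exactness/IMHCommonRandomNumbersContraction` for the exact one-plaquette heat-bath sampler (`A = Z/(c^{#B}M^k)`).  Setting as in
`Scaling/AutoregressiveGauge…CommonRandomNumbers` (GEN-36): the CRN pair kernel `K̂` feeds the SAME proposals and uniforms to two runs;
`A` is the sampler's acceptance at the cold configuration (displayed), `1/A` its cold weight.
Two runs on ONE stream of proposals and uniforms (CRN pair kernel `K̂`), from EVERY initial coupling `μ̂₀` (Hausdorff `G`, so that the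
diagonal is measurable):

* **`heatBath_crn_disagreement_le`** — `P(U_n ≠ U′_n) ≤ (1 − A)ⁿ·P(U_0 ≠ U′_0)`: the residual pair kernel never splits a merged pair, so the
  any-coupling bound `(1 − A)ⁿ` of GEN-36 is multiplied by the INITIAL disagreement probability;
* **`heatBath_crn_agreement_ge`** — `P(U_n = U′_n) ≥ 1 − (1 − A)ⁿ·P(U_0 ≠ U′_0)`;
* **`heatBath_crn_observable_diff_le`** — on the pair path law, `E|g(U_n) − g(U′_n)| ≤ (1 − A)ⁿ·P(U_0 ≠ U′_0)·(c − a)` for measurable `a ≤ g ≤ c`.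

Reading: re-coupling two exact gauge runs after a perturbation that leaves them equal with probability `1 − p` costs `log(p/δ)/A`
shared updates, not `log(1/δ)/A`.

NOT CLAIMED: the path-space «coincide forever» form with the factor `P(U_0 ≠ U′_0)`; any value of `A`.  No `def`, no `sorry`, nothing cited as a fact.
-/

noncomputable section

namespace Summit.Ventures.LatticeQCDFlow.Theory2.Autoregressive

open MeasureTheory ProbabilityTheory Function Finset
open scoped ENNReal unitInterval
open Literature.MathematicalPhysics.QuantumFieldTheory Literature.MathematicalPhysics.QuantumLattice
open Summit.Ventures.LatticeQCDFlow.Exactness Summit.Ventures.LatticeQCDFlow.Scoring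

variable {d L : ℕ} [NeZero L] {G : Type*} [Group G] [TopologicalSpace G] [IsTopologicalGroup G]
  [CompactSpace G] [SecondCountableTopology G] [MeasurableSpace G] [BorelSpace G]

/-- **`P(U_n ≠ U′_n) ≤ (1 − A)ⁿ·P(U_0 ≠ U′_0)`** from every initial coupling (the exact one-plaquette heat-bath sampler (`A = Z/(c^{#B}M^k)`); Hausdorff `G`). [ours] -/
theorem heatBath_crn_disagreement_le [T2Space G] [MeasurableSingletonClass G] (hL : 2 ≤ L) {w : G → ℝ} (hw : Continuous w) {m M : ℝ} (hm0 : 0 < m)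
    (hm : ∀ g, m ≤ w g) (hM : ∀ g, w g ≤ M) (hw1 : w 1 = M)
    (B : Finset (Plaquette d L)) (t : Plaquette d L → Edge d L)
    (ht : ∀ p ∈ B, t p ∈ ({(p.1, p.2.1.1), (p.1.shift p.2.1.1, p.2.1.2),
        (p.1.shift p.2.1.2, p.2.1.1), (p.1, p.2.1.2)} : Finset (Edge d L)))
    (rank : Plaquette d L → ℕ)
    (hrank : ∀ p ∈ B, ∀ p' ∈ B, p ≠ p' → t p ∈ ({(p'.1, p'.2.1.1), (p'.1.shift p'.2.1.1, p'.2.1.2),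
        (p'.1.shift p'.2.1.2, p'.2.1.1), (p'.1, p'.2.1.2)} : Finset (Edge d L)) → rank p < rank p')
    (π q : Measure (GaugeConfig d L G)) [IsProbabilityMeasure π] [IsProbabilityMeasure q]
    (hπ : π = (Measure.pi fun _ : Edge d L => haarProbability G).withDensity fun U =>
      ENNReal.ofReal ((∏ p : Plaquette d L, w (plaquetteHolonomy U p.1 p.2.1.1 p.2.1.2)) /
        ∫ V, ∏ p : Plaquette d L, w (plaquetteHolonomy V p.1 p.2.1.1 p.2.1.2)
          ∂(Measure.pi fun _ : Edge d L => haarProbability G)))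
    (hq : q = (Measure.pi fun _ : Edge d L => haarProbability G).withDensity fun U =>
      ENNReal.ofReal ((∏ p ∈ B, w (plaquetteHolonomy U p.1 p.2.1.1 p.2.1.2)) /
        ∫ V, ∏ p ∈ B, w (plaquetteHolonomy V p.1 p.2.1.1 p.2.1.2)
          ∂(Measure.pi fun _ : Edge d L => haarProbability G)))
    [Fact (Measurable (fun U =>
        ((∫ V, ∏ p : Plaquette d L, w (plaquetteHolonomy V p.1 p.2.1.1 p.2.1.2) ∂(Measure.pi fun _ : Edge d L => haarProbability G)) /
          ((∫ V, ∏ p ∈ B, w (plaquetteHolonomy V p.1 p.2.1.1 p.2.1.2)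
            ∂(Measure.pi fun _ : Edge d L => haarProbability G)) *
            ∏ p ∈ Finset.univ \ B, w (plaquetteHolonomy U p.1 p.2.1.1 p.2.1.2)))⁻¹))]
    (Khat : Kernel (GaugeConfig d L G × GaugeConfig d L G) (GaugeConfig d L G × GaugeConfig d L G))
    [IsMarkovKernel Khat]
    (hK : ∀ z : GaugeConfig d L G × GaugeConfig d L G, Khat z =
      (q.prod (volume : Measure unitInterval)).map (fun p : GaugeConfig d L G × unitInterval =>
        ((if (p.2 : ℝ) * (fun U =>
        ((∫ V, ∏ p : Plaquette d L, w (plaquetteHolonomy V p.1 p.2.1.1 p.2.1.2) ∂(Measure.pi fun _ : Edge d L => haarProbability G)) /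
          ((∫ V, ∏ p ∈ B, w (plaquetteHolonomy V p.1 p.2.1.1 p.2.1.2)
            ∂(Measure.pi fun _ : Edge d L => haarProbability G)) *
            ∏ p ∈ Finset.univ \ B, w (plaquetteHolonomy U p.1 p.2.1.1 p.2.1.2)))⁻¹) z.1 ≤ (fun U =>
        ((∫ V, ∏ p : Plaquette d L, w (plaquetteHolonomy V p.1 p.2.1.1 p.2.1.2) ∂(Measure.pi fun _ : Edge d L => haarProbability G)) /
          ((∫ V, ∏ p ∈ B, w (plaquetteHolonomy V p.1 p.2.1.1 p.2.1.2)
            ∂(Measure.pi fun _ : Edge d L => haarProbability G)) *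
            ∏ p ∈ Finset.univ \ B, w (plaquetteHolonomy U p.1 p.2.1.1 p.2.1.2)))⁻¹) p.1 then p.1 else z.1),
          (if (p.2 : ℝ) * (fun U =>
        ((∫ V, ∏ p : Plaquette d L, w (plaquetteHolonomy V p.1 p.2.1.1 p.2.1.2) ∂(Measure.pi fun _ : Edge d L => haarProbability G)) /
          ((∫ V, ∏ p ∈ B, w (plaquetteHolonomy V p.1 p.2.1.1 p.2.1.2)
            ∂(Measure.pi fun _ : Edge d L => haarProbability G)) *
            ∏ p ∈ Finset.univ \ B, w (plaquetteHolonomy U p.1 p.2.1.1 p.2.1.2)))⁻¹) z.2 ≤ (fun U =>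
        ((∫ V, ∏ p : Plaquette d L, w (plaquetteHolonomy V p.1 p.2.1.1 p.2.1.2) ∂(Measure.pi fun _ : Edge d L => haarProbability G)) /
          ((∫ V, ∏ p ∈ B, w (plaquetteHolonomy V p.1 p.2.1.1 p.2.1.2)
            ∂(Measure.pi fun _ : Edge d L => haarProbability G)) *
            ∏ p ∈ Finset.univ \ B, w (plaquetteHolonomy U p.1 p.2.1.1 p.2.1.2)))⁻¹) p.1 then p.1 else z.2))))
(n : ℕ) (μ₀ : Measure (GaugeConfig d L G × GaugeConfig d L G)) [IsProbabilityMeasure μ₀] :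
    ((fun m : Measure (GaugeConfig d L G × GaugeConfig d L G) => m.bind Khat)^[n] μ₀).real (Set.diagonal (GaugeConfig d L G))ᶜ ≤
      (1 - (((∫ V, ∏ p : Plaquette d L, w (plaquetteHolonomy V p.1 p.2.1.1 p.2.1.2) ∂(Measure.pi fun _ : Edge d L => haarProbability G)) /
        ((∫ g, w g ∂(haarProbability G)) ^ B.card * M ^ (Finset.univ \ B).card)))) ^ n * μ₀.real (Set.diagonal (GaugeConfig d L G))ᶜ := by
  obtain ⟨hA, hρq, hmax, hρm, hρpos⟩ := heatBath_cold_acceptMass_eq hL hw hm0 hm hM hw1 B t ht rank hrank π q hπ hq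
  set cold : GaugeConfig d L G := fun _ => (1 : G) with hcold
  set ρ : GaugeConfig d L G → ℝ := fun U => ((∫ V, ∏ p : Plaquette d L, w (plaquetteHolonomy V p.1 p.2.1.1 p.2.1.2) ∂(Measure.pi fun _ : Edge d L => haarProbability G)) /
          ((∫ V, ∏ p ∈ B, w (plaquetteHolonomy V p.1 p.2.1.1 p.2.1.2)
            ∂(Measure.pi fun _ : Edge d L => haarProbability G)) *
            ∏ p ∈ Finset.univ \ B, w (plaquetteHolonomy U p.1 p.2.1.1 p.2.1.2))) with hρ
  have hw0' : ∀ U, 0 < (ρ U)⁻¹ := fun U => inv_pos.2 (hρpos U)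
  have hπ' : (q.withDensity fun U => ENNReal.ofReal (ρ U)⁻¹) = π := withDensity_inv_density hρm hρpos hρq
  haveI : IsProbabilityMeasure (q.withDensity fun U => ENNReal.ofReal (ρ U)⁻¹) := by rw [hπ']; infer_instance
  have hone : ∫⁻ y, ENNReal.ofReal (ρ y)⁻¹ ∂q = ENNReal.ofReal 1 := by
    have h : π Set.univ = 1 := measure_univ
    rw [← hπ', withDensity_apply _ MeasurableSet.univ, Measure.restrict_univ] at h
    rw [h, ENNReal.ofReal_one]
  have hA' := imhAcceptMass_toReal_eq_of_forall_le (q := q) hw0' cold hmax zero_le_one hone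
  have hrate : ((ρ cold)⁻¹)⁻¹ = ((∫ V, ∏ p : Plaquette d L, w (plaquetteHolonomy V p.1 p.2.1.1 p.2.1.2) ∂(Measure.pi fun _ : Edge d L => haarProbability G)) /
        ((∫ g, w g ∂(haarProbability G)) ^ B.card * M ^ (Finset.univ \ B).card)) := by
    rw [← hA, hA', one_div]
  have hwm : Measurable fun U => (ρ U)⁻¹ := hρm.inv
  have h := iterate_bind_crnPair_offDiagonal_le (q := q) hwm hw0' hmax Khat hK n μ₀ (x₀ := cold)
  rw [hrate] at h
  exact h

/-- **`P(U_n = U′_n) ≥ 1 − (1 − A)ⁿ·P(U_0 ≠ U′_0)`** from every initial coupling (the exact one-plaquette heat-bath sampler (`A = Z/(c^{#B}M^k)`); Hausdorff `G`). [ours] -/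
theorem heatBath_crn_agreement_ge [T2Space G] [MeasurableSingletonClass G] (hL : 2 ≤ L) {w : G → ℝ} (hw : Continuous w) {m M : ℝ} (hm0 : 0 < m)
    (hm : ∀ g, m ≤ w g) (hM : ∀ g, w g ≤ M) (hw1 : w 1 = M)
    (B : Finset (Plaquette d L)) (t : Plaquette d L → Edge d L)
    (ht : ∀ p ∈ B, t p ∈ ({(p.1, p.2.1.1), (p.1.shift p.2.1.1, p.2.1.2),
        (p.1.shift p.2.1.2, p.2.1.1), (p.1, p.2.1.2)} : Finset (Edge d L)))
    (rank : Plaquette d L → ℕ)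
    (hrank : ∀ p ∈ B, ∀ p' ∈ B, p ≠ p' → t p ∈ ({(p'.1, p'.2.1.1), (p'.1.shift p'.2.1.1, p'.2.1.2),
        (p'.1.shift p'.2.1.2, p'.2.1.1), (p'.1, p'.2.1.2)} : Finset (Edge d L)) → rank p < rank p')
    (π q : Measure (GaugeConfig d L G)) [IsProbabilityMeasure π] [IsProbabilityMeasure q]
    (hπ : π = (Measure.pi fun _ : Edge d L => haarProbability G).withDensity fun U =>
      ENNReal.ofReal ((∏ p : Plaquette d L, w (plaquetteHolonomy U p.1 p.2.1.1 p.2.1.2)) /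
        ∫ V, ∏ p : Plaquette d L, w (plaquetteHolonomy V p.1 p.2.1.1 p.2.1.2)
          ∂(Measure.pi fun _ : Edge d L => haarProbability G)))
    (hq : q = (Measure.pi fun _ : Edge d L => haarProbability G).withDensity fun U =>
      ENNReal.ofReal ((∏ p ∈ B, w (plaquetteHolonomy U p.1 p.2.1.1 p.2.1.2)) /
        ∫ V, ∏ p ∈ B, w (plaquetteHolonomy V p.1 p.2.1.1 p.2.1.2)
          ∂(Measure.pi fun _ : Edge d L => haarProbability G)))
    [Fact (Measurable (fun U =>
        ((∫ V, ∏ p : Plaquette d L, w (plaquetteHolonomy V p.1 p.2.1.1 p.2.1.2) ∂(Measure.pi fun _ : Edge d L => haarProbability G)) /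
          ((∫ V, ∏ p ∈ B, w (plaquetteHolonomy V p.1 p.2.1.1 p.2.1.2)
            ∂(Measure.pi fun _ : Edge d L => haarProbability G)) *
            ∏ p ∈ Finset.univ \ B, w (plaquetteHolonomy U p.1 p.2.1.1 p.2.1.2)))⁻¹))]
    (Khat : Kernel (GaugeConfig d L G × GaugeConfig d L G) (GaugeConfig d L G × GaugeConfig d L G))
    [IsMarkovKernel Khat]
    (hK : ∀ z : GaugeConfig d L G × GaugeConfig d L G, Khat z =
      (q.prod (volume : Measure unitInterval)).map (fun p : GaugeConfig d L G × unitInterval =>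
        ((if (p.2 : ℝ) * (fun U =>
        ((∫ V, ∏ p : Plaquette d L, w (plaquetteHolonomy V p.1 p.2.1.1 p.2.1.2) ∂(Measure.pi fun _ : Edge d L => haarProbability G)) /
          ((∫ V, ∏ p ∈ B, w (plaquetteHolonomy V p.1 p.2.1.1 p.2.1.2)
            ∂(Measure.pi fun _ : Edge d L => haarProbability G)) *
            ∏ p ∈ Finset.univ \ B, w (plaquetteHolonomy U p.1 p.2.1.1 p.2.1.2)))⁻¹) z.1 ≤ (fun U =>
        ((∫ V, ∏ p : Plaquette d L, w (plaquetteHolonomy V p.1 p.2.1.1 p.2.1.2) ∂(Measure.pi fun _ : Edge d L => haarProbability G)) /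
          ((∫ V, ∏ p ∈ B, w (plaquetteHolonomy V p.1 p.2.1.1 p.2.1.2)
            ∂(Measure.pi fun _ : Edge d L => haarProbability G)) *
            ∏ p ∈ Finset.univ \ B, w (plaquetteHolonomy U p.1 p.2.1.1 p.2.1.2)))⁻¹) p.1 then p.1 else z.1),
          (if (p.2 : ℝ) * (fun U =>
        ((∫ V, ∏ p : Plaquette d L, w (plaquetteHolonomy V p.1 p.2.1.1 p.2.1.2) ∂(Measure.pi fun _ : Edge d L => haarProbability G)) /
          ((∫ V, ∏ p ∈ B, w (plaquetteHolonomy V p.1 p.2.1.1 p.2.1.2)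
            ∂(Measure.pi fun _ : Edge d L => haarProbability G)) *
            ∏ p ∈ Finset.univ \ B, w (plaquetteHolonomy U p.1 p.2.1.1 p.2.1.2)))⁻¹) z.2 ≤ (fun U =>
        ((∫ V, ∏ p : Plaquette d L, w (plaquetteHolonomy V p.1 p.2.1.1 p.2.1.2) ∂(Measure.pi fun _ : Edge d L => haarProbability G)) /
          ((∫ V, ∏ p ∈ B, w (plaquetteHolonomy V p.1 p.2.1.1 p.2.1.2)
            ∂(Measure.pi fun _ : Edge d L => haarProbability G)) *
            ∏ p ∈ Finset.univ \ B, w (plaquetteHolonomy U p.1 p.2.1.1 p.2.1.2)))⁻¹) p.1 then p.1 else z.2))))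
(n : ℕ) (μ₀ : Measure (GaugeConfig d L G × GaugeConfig d L G)) [IsProbabilityMeasure μ₀] :
    1 - (1 - (((∫ V, ∏ p : Plaquette d L, w (plaquetteHolonomy V p.1 p.2.1.1 p.2.1.2) ∂(Measure.pi fun _ : Edge d L => haarProbability G)) /
        ((∫ g, w g ∂(haarProbability G)) ^ B.card * M ^ (Finset.univ \ B).card)))) ^ n * μ₀.real (Set.diagonal (GaugeConfig d L G))ᶜ ≤
      ((fun m : Measure (GaugeConfig d L G × GaugeConfig d L G) => m.bind Khat)^[n] μ₀).real (Set.diagonal (GaugeConfig d L G)) := by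
  obtain ⟨hA, hρq, hmax, hρm, hρpos⟩ := heatBath_cold_acceptMass_eq hL hw hm0 hm hM hw1 B t ht rank hrank π q hπ hq
  set cold : GaugeConfig d L G := fun _ => (1 : G) with hcold
  set ρ : GaugeConfig d L G → ℝ := fun U => ((∫ V, ∏ p : Plaquette d L, w (plaquetteHolonomy V p.1 p.2.1.1 p.2.1.2) ∂(Measure.pi fun _ : Edge d L => haarProbability G)) /
          ((∫ V, ∏ p ∈ B, w (plaquetteHolonomy V p.1 p.2.1.1 p.2.1.2)
            ∂(Measure.pi fun _ : Edge d L => haarProbability G)) *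
            ∏ p ∈ Finset.univ \ B, w (plaquetteHolonomy U p.1 p.2.1.1 p.2.1.2))) with hρ
  have hw0' : ∀ U, 0 < (ρ U)⁻¹ := fun U => inv_pos.2 (hρpos U)
  have hπ' : (q.withDensity fun U => ENNReal.ofReal (ρ U)⁻¹) = π := withDensity_inv_density hρm hρpos hρq
  haveI : IsProbabilityMeasure (q.withDensity fun U => ENNReal.ofReal (ρ U)⁻¹) := by rw [hπ']; infer_instance
  have hone : ∫⁻ y, ENNReal.ofReal (ρ y)⁻¹ ∂q = ENNReal.ofReal 1 := by
    have h : π Set.univ = 1 := measure_univ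
    rw [← hπ', withDensity_apply _ MeasurableSet.univ, Measure.restrict_univ] at h
    rw [h, ENNReal.ofReal_one]
  have hA' := imhAcceptMass_toReal_eq_of_forall_le (q := q) hw0' cold hmax zero_le_one hone
  have hrate : ((ρ cold)⁻¹)⁻¹ = ((∫ V, ∏ p : Plaquette d L, w (plaquetteHolonomy V p.1 p.2.1.1 p.2.1.2) ∂(Measure.pi fun _ : Edge d L => haarProbability G)) /
        ((∫ g, w g ∂(haarProbability G)) ^ B.card * M ^ (Finset.univ \ B).card)) := by
    rw [← hA, hA', one_div]
  have hwm : Measurable fun U => (ρ U)⁻¹ := hρm.inv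
  have h := iterate_bind_crnPair_diagonal_ge_init (q := q) hwm hw0' hmax Khat hK n μ₀ (x₀ := cold)
  rw [hrate] at h
  exact h

/-- **`E|g(U_n) − g(U′_n)| ≤ (1 − A)ⁿ·P(U_0 ≠ U′_0)·(c − a)`** on the pair path law, for measurable `a ≤ g ≤ c` (the exact one-plaquette heat-bath sampler (`A = Z/(c^{#B}M^k)`); Hausdorff `G`). [ours] -/
theorem heatBath_crn_observable_diff_le [T2Space G] [MeasurableSingletonClass G] (hL : 2 ≤ L) {w : G → ℝ} (hw : Continuous w) {m M : ℝ} (hm0 : 0 < m)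
    (hm : ∀ g, m ≤ w g) (hM : ∀ g, w g ≤ M) (hw1 : w 1 = M)
    (B : Finset (Plaquette d L)) (t : Plaquette d L → Edge d L)
    (ht : ∀ p ∈ B, t p ∈ ({(p.1, p.2.1.1), (p.1.shift p.2.1.1, p.2.1.2),
        (p.1.shift p.2.1.2, p.2.1.1), (p.1, p.2.1.2)} : Finset (Edge d L)))
    (rank : Plaquette d L → ℕ)
    (hrank : ∀ p ∈ B, ∀ p' ∈ B, p ≠ p' → t p ∈ ({(p'.1, p'.2.1.1), (p'.1.shift p'.2.1.1, p'.2.1.2),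
        (p'.1.shift p'.2.1.2, p'.2.1.1), (p'.1, p'.2.1.2)} : Finset (Edge d L)) → rank p < rank p')
    (π q : Measure (GaugeConfig d L G)) [IsProbabilityMeasure π] [IsProbabilityMeasure q]
    (hπ : π = (Measure.pi fun _ : Edge d L => haarProbability G).withDensity fun U =>
      ENNReal.ofReal ((∏ p : Plaquette d L, w (plaquetteHolonomy U p.1 p.2.1.1 p.2.1.2)) /
        ∫ V, ∏ p : Plaquette d L, w (plaquetteHolonomy V p.1 p.2.1.1 p.2.1.2)
          ∂(Measure.pi fun _ : Edge d L => haarProbability G)))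
    (hq : q = (Measure.pi fun _ : Edge d L => haarProbability G).withDensity fun U =>
      ENNReal.ofReal ((∏ p ∈ B, w (plaquetteHolonomy U p.1 p.2.1.1 p.2.1.2)) /
        ∫ V, ∏ p ∈ B, w (plaquetteHolonomy V p.1 p.2.1.1 p.2.1.2)
          ∂(Measure.pi fun _ : Edge d L => haarProbability G)))
    [Fact (Measurable (fun U =>
        ((∫ V, ∏ p : Plaquette d L, w (plaquetteHolonomy V p.1 p.2.1.1 p.2.1.2) ∂(Measure.pi fun _ : Edge d L => haarProbability G)) /
          ((∫ V, ∏ p ∈ B, w (plaquetteHolonomy V p.1 p.2.1.1 p.2.1.2)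
            ∂(Measure.pi fun _ : Edge d L => haarProbability G)) *
            ∏ p ∈ Finset.univ \ B, w (plaquetteHolonomy U p.1 p.2.1.1 p.2.1.2)))⁻¹))]
    (Khat : Kernel (GaugeConfig d L G × GaugeConfig d L G) (GaugeConfig d L G × GaugeConfig d L G))
    [IsMarkovKernel Khat]
    (hK : ∀ z : GaugeConfig d L G × GaugeConfig d L G, Khat z =
      (q.prod (volume : Measure unitInterval)).map (fun p : GaugeConfig d L G × unitInterval =>
        ((if (p.2 : ℝ) * (fun U =>
        ((∫ V, ∏ p : Plaquette d L, w (plaquetteHolonomy V p.1 p.2.1.1 p.2.1.2) ∂(Measure.pi fun _ : Edge d L => haarProbability G)) /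
          ((∫ V, ∏ p ∈ B, w (plaquetteHolonomy V p.1 p.2.1.1 p.2.1.2)
            ∂(Measure.pi fun _ : Edge d L => haarProbability G)) *
            ∏ p ∈ Finset.univ \ B, w (plaquetteHolonomy U p.1 p.2.1.1 p.2.1.2)))⁻¹) z.1 ≤ (fun U =>
        ((∫ V, ∏ p : Plaquette d L, w (plaquetteHolonomy V p.1 p.2.1.1 p.2.1.2) ∂(Measure.pi fun _ : Edge d L => haarProbability G)) /
          ((∫ V, ∏ p ∈ B, w (plaquetteHolonomy V p.1 p.2.1.1 p.2.1.2)
            ∂(Measure.pi fun _ : Edge d L => haarProbability G)) *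
            ∏ p ∈ Finset.univ \ B, w (plaquetteHolonomy U p.1 p.2.1.1 p.2.1.2)))⁻¹) p.1 then p.1 else z.1),
          (if (p.2 : ℝ) * (fun U =>
        ((∫ V, ∏ p : Plaquette d L, w (plaquetteHolonomy V p.1 p.2.1.1 p.2.1.2) ∂(Measure.pi fun _ : Edge d L => haarProbability G)) /
          ((∫ V, ∏ p ∈ B, w (plaquetteHolonomy V p.1 p.2.1.1 p.2.1.2)
            ∂(Measure.pi fun _ : Edge d L => haarProbability G)) *
            ∏ p ∈ Finset.univ \ B, w (plaquetteHolonomy U p.1 p.2.1.1 p.2.1.2)))⁻¹) z.2 ≤ (fun U =>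
        ((∫ V, ∏ p : Plaquette d L, w (plaquetteHolonomy V p.1 p.2.1.1 p.2.1.2) ∂(Measure.pi fun _ : Edge d L => haarProbability G)) /
          ((∫ V, ∏ p ∈ B, w (plaquetteHolonomy V p.1 p.2.1.1 p.2.1.2)
            ∂(Measure.pi fun _ : Edge d L => haarProbability G)) *
            ∏ p ∈ Finset.univ \ B, w (plaquetteHolonomy U p.1 p.2.1.1 p.2.1.2)))⁻¹) p.1 then p.1 else z.2))))
(μ₀ : Measure (GaugeConfig d L G × GaugeConfig d L G)) [IsProbabilityMeasure μ₀]
    {g : GaugeConfig d L G → ℝ} (hg : Measurable g) {a c : ℝ} (ha : ∀ x, a ≤ g x) (hc : ∀ x, g x ≤ c) (n : ℕ) :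
    ∫ z, |g ((z n).1) - g ((z n).2)| ∂(Kernel.trajMeasure (X := fun _ : ℕ => GaugeConfig d L G × GaugeConfig d L G) μ₀
          (fun n : ℕ => Khat.comap (fun h : (i : ↥(Finset.Iic n)) → GaugeConfig d L G × GaugeConfig d L G => h ⟨n, Finset.mem_Iic.2 le_rfl⟩)
            (measurable_pi_apply _))) ≤ (1 - (((∫ V, ∏ p : Plaquette d L, w (plaquetteHolonomy V p.1 p.2.1.1 p.2.1.2) ∂(Measure.pi fun _ : Edge d L => haarProbability G)) /
        ((∫ g, w g ∂(haarProbability G)) ^ B.card * M ^ (Finset.univ \ B).card)))) ^ n * μ₀.real (Set.diagonal (GaugeConfig d L G))ᶜ * (c - a) := by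
  obtain ⟨hA, hρq, hmax, hρm, hρpos⟩ := heatBath_cold_acceptMass_eq hL hw hm0 hm hM hw1 B t ht rank hrank π q hπ hq
  set cold : GaugeConfig d L G := fun _ => (1 : G) with hcold
  set ρ : GaugeConfig d L G → ℝ := fun U => ((∫ V, ∏ p : Plaquette d L, w (plaquetteHolonomy V p.1 p.2.1.1 p.2.1.2) ∂(Measure.pi fun _ : Edge d L => haarProbability G)) /
          ((∫ V, ∏ p ∈ B, w (plaquetteHolonomy V p.1 p.2.1.1 p.2.1.2)
            ∂(Measure.pi fun _ : Edge d L => haarProbability G)) *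
            ∏ p ∈ Finset.univ \ B, w (plaquetteHolonomy U p.1 p.2.1.1 p.2.1.2))) with hρ
  have hw0' : ∀ U, 0 < (ρ U)⁻¹ := fun U => inv_pos.2 (hρpos U)
  have hπ' : (q.withDensity fun U => ENNReal.ofReal (ρ U)⁻¹) = π := withDensity_inv_density hρm hρpos hρq
  haveI : IsProbabilityMeasure (q.withDensity fun U => ENNReal.ofReal (ρ U)⁻¹) := by rw [hπ']; infer_instance
  have hone : ∫⁻ y, ENNReal.ofReal (ρ y)⁻¹ ∂q = ENNReal.ofReal 1 := by
    have h : π Set.univ = 1 := measure_univ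
    rw [← hπ', withDensity_apply _ MeasurableSet.univ, Measure.restrict_univ] at h
    rw [h, ENNReal.ofReal_one]
  have hA' := imhAcceptMass_toReal_eq_of_forall_le (q := q) hw0' cold hmax zero_le_one hone
  have hrate : ((ρ cold)⁻¹)⁻¹ = ((∫ V, ∏ p : Plaquette d L, w (plaquetteHolonomy V p.1 p.2.1.1 p.2.1.2) ∂(Measure.pi fun _ : Edge d L => haarProbability G)) /
        ((∫ g, w g ∂(haarProbability G)) ^ B.card * M ^ (Finset.univ \ B).card)) := by
    rw [← hA, hA', one_div]
  have h := crn_chain_integral_abs_sub_le_init (q := q) hw0' hmax Khat hK μ₀ hg ha hc n (x₀ := cold)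
  rw [hrate] at h
  exact h

end Summit.Ventures.LatticeQCDFlow.Theory2.Autoregressive

end
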